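import Literature.Probability.RandomPlanarGeometry.RestrictionMeasuresFiveEighthsPositivity
import Literature.Probability.RandomPlanarGeometry.RestrictionMeasuresExistenceHolds
import Literature.Probability.RandomPlanarGeometry.CritPercSLESwallowingProofs
import Literature.Probability.RandomPlanarGeometry.SimplePathConfig
import Literature.Topology.PlaneTopology.ArcGluing
import HarnessLib

/-!
# [LSW] p. 5 result 2 without §7: the `α > 5/8` half from one-sided restriction, and the fact from two leaves

Proof-only companion (no definition, no named fact) of `RestrictionMeasures` /
`RestrictionMeasuresFiveEighths` for the named facts
`Literature.Probability.RandomPlanarGeometry.IsRestrictionMeasure.eq_five_eighths_of_simple` and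
`Literature.Probability.RandomPlanarGeometry.IsRestrictionMeasure.eq_five_eighths_of_outer_simple`
([LSW] p. 5 result 2, first sentence: "The only measure `P_α` that is supported on simple curves
is `P_{5/8}`"), after

* G. F. Lawler, O. Schramm, W. Werner, *Conformal restriction: the chordal case*, J. Amer. Math.
  Soc. **16** (2003) 917–955, arXiv:math/0209343 (**[LSW]**), §8.1 (p. 31: `P⁺_α`, its
  uniqueness, "For `α ≥ 5/8`, we may obtain `P⁺_α` by applying `F^{ℝ₊}_ℍ` to a sample from the
  two sided restriction measure `P_α`"), §8.2 (sentence preceding Prop. 8.2: "Taking unions of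
  independent hulls which satisfy the right-sided restriction property, yields a realization of
  another right-sided restriction measure (and the exponent add up)") and the proof of Cor. 8.6
  (p. 38: "the `P_α` probability that `i` ends up to the 'right' of `K` is at most `1/2` (it can
  be smaller if `K` is of positive Lebesgue measure)");
* S. Rohde, O. Schramm, *Basic properties of SLE*, Ann. of Math. **161** (2005), Thm. 6.4 (a
  fixed point of `ℍ` is a.s. off the SLE_κ trace, `κ < 8`);
* J. McCleary, *A First Course in Topology* (2006), Ch. 9 (the Jordan curve theorem: each
  complementary component has the curve as frontier; the separation theorem for Jordan arcs).

In [LSW] the `α > 5/8` half of p. 5 result 2 is Thm. 7.3 (`P_α`, `α > 5/8`, is SLE_κ decorated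
with a Poisson cloud of Brownian bubbles, hence has interior points) with the uniqueness of
`P_α`; in the tree this is the three §7 leaves (`exists_isBrownianBubbleMeasure_ae_interior_nonempty`,
`SLEBubbles.ae_mem_restrictionConfigs`, `SLEBubbles.lintegral_poissonAvoidance_eq_rpow`) of
`IsRestrictionMeasure.eq_five_eighths_of_outer_simple_of_five_leaves`
(`ConformalRestrictionFiveLeaves`). This file proves that half by a DIFFERENT, purely one-sided
argument, which needs from §8 only what the `α < 5/8` half (Cor. 8.6) already needs, plus an
"interior" form of the small-`β` positivity. For a two-sided restriction measure `P` of exponent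
`α = 5/8 + β`, `β > 0`, carried by simple curves, let `Q = F^{ℝ₊}_ℍ(P) = P⁺_α`
(`IsRestrictionMeasure.map_leftFillConfig`), `Q₁ = F^{ℝ₊}_ℍ(P_{5/8}) = P⁺_{5/8}` (`P_{5/8}`
exists, Thm. 6.1, `exists_isRestrictionMeasure_five_eighths`), `Q₂ = P⁺_β`, so that
`Q = F(Q₁ ⊗ Q₂)` by §8.2 and uniqueness (`IsRightRestrictionMeasure.fillUnion`, `.unique`); write
`r = P(i right of K)`, `b = P(i ∈ K)`, `s = Q₂(i ∈ K)`, `q = Q₂(i ∈ int K)`: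

1. `2r + b = 1` (`IsRestrictionMeasure.two_mul_measure_rightOf_I_add`: a point of `ℍ` off `K` is
   strictly right or strictly left of `K`, `RestrictionConfig.mem_rightDomain_or_mem_leftDomain`,
   and `P` is `σ`-invariant); for `P_{5/8}`, `b = 0` (the SLE_{8/3} curve misses `i`,
   `IsRestrictionMeasure.measure_setOf_I_mem_eq_zero_of_five_eighths`), so `Q₁(i ∉ K) = 1/2`;
2. `r = Q(i ∉ K) ≤ Q₁(i ∉ K) · Q₂(i ∉ K) = (1 − s)/2` (`IsRightRestrictionMeasure.measure_notMem_le_mul`),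
   whence `s ≤ b`;
3. the right-boundary event `Bd = {i ∈ K, i ∉ int K}` on `Ω₊` satisfies
   `Q(Bd) ≤ Q₁(Bd) + Q₂(Bd)` — a boundary point of the filled union `F(K₁ ∪ K₂)` lies on
   `K₁ ∪ K₂` (`RightConfig.mem_union_of_mem_fillUnion_of_notMem_interior`) — with
   `Q₁(Bd) ≤ P_{5/8}(i ∈ K) = 0` (`RestrictionConfig.I_mem_of_leftFill`: a frontier point of the
   right domain lies on `K`) and `Q₂(Bd) = s − q`;
4. **plane topology** (`IsChordalSimplePath.mem_closure_rightDomain`): every point of a simple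
   curve from `0` to `∞` in `ℍ` is a limit of points strictly to its right — remove a small open
   arc around the point from the mirror double `γ ∪ conj γ`; what is left is, through `∞`, a
   Jordan arc (three arcs glued end to end after an inversion, `isSimpleArc_inv_image_range`,
   `IsSimpleArc.union`), which does not separate the plane (`JordanArcSeparation_holds`); a path
   from `1` to `−1` missing it must meet the curve (`−1` is not to the right of the curve,
   `RestrictionConfig.neg_one_notMem_rightDomain`), first on the small arc — so for `P` carried
   by simple curves `b ≤ Q(Bd)`;
5. hence `b + q ≤ s ≤ b` and `q = 0`: **`P⁺_β` cannot make `i` an interior point of `K` with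
   positive probability** (`IsRestrictionMeasure.false_of_outer_simple_of_intPos`).

Interior positivity moves up in the exponent (`F(K₁ ∪ K₂) ⊇ K₁`,
`IsRightRestrictionMeasure.measure_I_mem_interior_ne_zero_mono`), so the `α > 5/8` half follows
from the existence of all `P⁺_β` and the interior positivity for arbitrarily small `β`
(`IsRestrictionMeasure.not_five_eighths_lt_of_outer_simple`), and the named fact from these and
Cor. 8.6 (`IsRestrictionMeasure.eq_five_eighths_of_outer_simple_of_oneSided`). With Thm. 8.4 from
the martingale of Lemmas 8.9–8.10 (`exists_isRightRestrictionMeasure_of_martingale`,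
`not_exists_isRestrictionMeasure_of_lt_five_eighths_of_martingale_of_pos` of
`RestrictionMeasuresFiveEighthsProofs` / `…Positivity`):

* `IsRestrictionMeasure.eq_five_eighths_of_outer_simple_of_martingale_of_intPos`,
  `IsRestrictionMeasure.eq_five_eighths_of_simple_of_martingale_of_intPos`,
  `LawlerSchrammWerner2003_of_martingale_of_intPos` — **[LSW] p. 5 result 2 (both readings) and
  `LawlerSchrammWerner2003` from TWO leaves**: `SLEKappaRho.exists_isOneSidedMartingale`
  (Lemmas 8.9–8.10) and the small-`β` interior positivity
  `∀ ε > 0, ∃ β ≤ ε, ∃ P⁺_β, P⁺_β{i ∈ int K} > 0` (which implies the positivity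
  `P⁺_β{i ∉ K} < 1` of `RestrictionMeasuresFiveEighthsPositivity`, `pos_of_intPos`; for the
  SLE(8/3, ρ) realization of Thm. 8.4 it says that `i` lies strictly to the left of the curve
  with positive probability).

Measurability of the events used: `i ∈ K` on `Ω` is the tree's
`RestrictionConfig.measurableSet_mem` (`RestrictionConfigEvents`); `i ∈ cl(rightDomain K)` on `Ω`
and `z ∈ K'`, `i ∈ int K'` on `Ω₊` are proved from the tree's `measurableSet_rightOf`,
`RightConfig.measurableSet_notMem` with a countable dense set of test points. All statements are
proved; axioms `propext`, `Classical.choice`, `Quot.sound`.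

Mathlib: `TopologicalSpace.exists_countable_dense`, `Dense.exists_mem_open`,
`Dense.open_subset_closure_inter`, `interior_eq_compl_closure_compl`,
`Complex.closure_setOf_im_lt`, `IsOpen.isConnected_iff_isPathConnected`, `Path.extend`,
`IsClosed.csInf_mem`, `map_mem_closure`, `MeasureTheory.Measure.prod_prod`,
`MeasureTheory.prob_add_prob_compl`, `ENNReal.add_le_add_iff_left`. Tree: see the docstrings.

## References

* [LSW] p. 5 result 2; §8.1 (p. 31), §8.2 (Prop. 8.2), Thm. 8.4 (p. 37), Cor. 8.6 (pp. 37–38).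
  [LawlerSchrammWerner2003Restriction]
* S. Rohde, O. Schramm, *Basic properties of SLE*, Ann. of Math. 161 (2005), Thm. 6.4.
  [RohdeSchramm2005]
* J. McCleary, *A First Course in Topology: Continuity and Dimension*, AMS (2006), Ch. 9,
  pp. 129–130. [Mccleary2006]
-/

noncomputable section

open Set Filter Topology Metric Complex
open UpperHalfPlane (upperHalfPlaneSet)
open scoped NNReal ComplexConjugate
open Literature.Topology.PlaneTopology

namespace Literature.Probability.RandomPlanarGeometry

/-! ### A ray to infinity, inverted, is a simple arc ending at `0` -/

/-- For `β : [0, ∞) → ℂ` continuous and injective with `‖β t‖ → ∞` and `c ∉ β[0, ∞)`, the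
inversion `ι(z) = (z − c)⁻¹` carries `β[0, ∞) ∪ {∞}` onto a simple arc from `ι(β 0)` to `0`
(parametrise by `x ↦ ι(β(x/(1 − x)))` on `[0, 1)`, `1 ↦ 0`). [folklore] -/
theorem isSimpleArc_inv_image_range {β : ℝ≥0 → ℂ} (hβc : Continuous β)
    (hβi : Function.Injective β) (hβ : Tendsto (fun t ↦ ‖β t‖) atTop atTop) {c : ℂ}
    (hc : c ∉ range β) :
    IsSimpleArc ((fun z ↦ (z - c)⁻¹) '' range β ∪ {0}) ((β 0 - c)⁻¹) 0 := by
  classical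
  set ι : ℂ → ℂ := fun z ↦ (z - c)⁻¹ with hι
  have hβne : ∀ t, β t - c ≠ 0 := fun t h ↦ hc ⟨t, sub_eq_zero.1 h⟩
  have hιinj : ∀ {z w : ℂ}, ι z = ι w → z = w := fun h ↦ sub_left_injective (inv_inj.1 h)
  -- the reparametrisation `ρ : [0, 1) → [0, ∞)`
  set ρ : ℝ → ℝ := fun x ↦ x / (1 - x) with hρ
  have hρc : ContinuousOn ρ (Iio 1) := by
    refine continuousOn_id.div (continuousOn_const.sub continuousOn_id) fun x hx ↦ ?_
    exact (sub_pos.2 hx).ne'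
  have hρnn : ∀ {x : ℝ}, 0 ≤ x → x < 1 → 0 ≤ ρ x := fun hx hx1 ↦
    div_nonneg hx (sub_pos.2 hx1).le
  have hρinj : ∀ {x y : ℝ}, x < 1 → y < 1 → ρ x = ρ y → x = y := by
    intro x y hx hy hxy
    have hx' : (1 - x) ≠ 0 := (sub_pos.2 hx).ne'
    have hy' : (1 - y) ≠ 0 := (sub_pos.2 hy).ne'
    simp only [hρ] at hxy
    rw [div_eq_div_iff hx' hy'] at hxy
    nlinarith
  have hρsurj : ∀ t : ℝ, 0 ≤ t → ∃ x, 0 ≤ x ∧ x < 1 ∧ ρ x = t := fun t ht ↦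
    ⟨t / (1 + t), div_nonneg ht (by linarith), by rw [div_lt_one (by linarith)]; linarith, by
      simp only [hρ]
      have h1 : (1 + t) ≠ 0 := by linarith
      field_simp
      ring⟩
  have hρtop : Tendsto ρ (𝓝[<] 1) atTop := by
    have h1 : Tendsto (fun x : ℝ ↦ 1 - x) (𝓝[<] 1) (𝓝[>] 0) := by
      have : Tendsto (fun x : ℝ ↦ 1 - x) (𝓝 1) (𝓝 0) := by
        have h : Continuous fun x : ℝ ↦ 1 - x := by fun_prop
        simpa using h.tendsto (1 : ℝ)
      refine tendsto_nhdsWithin_of_tendsto_nhds_of_eventually_within _ (this.mono_left nhdsWithin_le_nhds) ?_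
      filter_upwards [self_mem_nhdsWithin] with x hx using sub_pos.2 (mem_Iio.1 hx)
    have h2 : Tendsto (fun x : ℝ ↦ (1 - x)⁻¹) (𝓝[<] 1) atTop := tendsto_inv_nhdsGT_zero.comp h1
    have h3 : Tendsto (fun x : ℝ ↦ x) (𝓝[<] (1 : ℝ)) (𝓝 1) := tendsto_nhdsWithin_of_tendsto_nhds tendsto_id
    have h4 : Tendsto (fun x : ℝ ↦ x * (1 - x)⁻¹) (𝓝[<] 1) atTop :=
      Tendsto.pos_mul_atTop one_pos h3 h2
    refine h4.congr' (Eventually.of_forall fun x ↦ ?_)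
    simp [hρ, div_eq_mul_inv]
  -- `B x = β (ρ x)` on `[0, 1)`
  set B : ℝ → ℂ := fun x ↦ β (ρ x).toNNReal with hB
  have hBc : ContinuousOn B (Ico 0 1) :=
    hβc.comp_continuousOn (continuous_real_toNNReal.comp_continuousOn (hρc.mono fun x hx ↦ hx.2))
  have hBtop : Tendsto B (𝓝[<] 1) (Bornology.cobounded ℂ) := by
    rw [← comap_norm_atTop, tendsto_comap_iff]
    have : Tendsto (fun x ↦ (ρ x).toNNReal) (𝓝[<] 1) atTop :=
      tendsto_real_toNNReal_atTop.comp hρtop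
    exact hβ.comp this
  -- the parametrisation `g`
  set g : ℝ → ℂ := fun x ↦ if x < 1 then ι (B x) else 0 with hg
  have hg_lt : ∀ {x : ℝ}, x < 1 → g x = ι (B x) := fun hx ↦ if_pos hx
  have hg_ge : ∀ {x : ℝ}, ¬ x < 1 → g x = 0 := fun hx ↦ if_neg hx
  have hg_one : g 1 = 0 := hg_ge (lt_irrefl _)
  have hιB : ContinuousOn (fun x ↦ ι (B x)) (Ico 0 1) :=
    ContinuousOn.inv₀ (hBc.sub continuousOn_const) fun x _ ↦ hβne _
  have hι0 : Tendsto (fun x ↦ ι (B x)) (𝓝[<] 1) (𝓝 0) := by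
    have h1 : Tendsto (fun x ↦ B x - c) (𝓝[<] 1) (Bornology.cobounded ℂ) :=
      (tendsto_sub_const_cobounded c).comp hBtop
    exact Filter.tendsto_inv₀_cobounded.comp h1
  have hgc : ContinuousOn g (Icc 0 1) := by
    intro x hx
    rcases hx.2.lt_or_eq with hx1 | rfl
    · have hmem : Ico (0 : ℝ) 1 ∈ 𝓝[Icc 0 1] x := by
        have : Ico (0 : ℝ) 1 = Icc 0 1 ∩ Iio 1 := by
          ext y; simp only [mem_Ico, mem_inter_iff, mem_Icc, mem_Iio]
          exact ⟨fun h ↦ ⟨⟨h.1, h.2.le⟩, h.2⟩, fun h ↦ ⟨h.1.1, h.2⟩⟩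
        rw [this]
        exact inter_mem_nhdsWithin _ (Iio_mem_nhds hx1)
      have h1 : ContinuousWithinAt (fun t : ℝ ↦ ι (B t)) (Icc 0 1) x :=
        (hιB x ⟨hx.1, hx1⟩).mono_of_mem_nhdsWithin hmem
      refine h1.congr_of_eventuallyEq ?_ (hg_lt hx1)
      filter_upwards [hmem] with y hy using hg_lt hy.2
    · change Tendsto g (𝓝[Icc 0 1] 1) (𝓝 (g 1))
      rw [hg_one]
      have hle : 𝓝[Icc (0 : ℝ) 1] 1 ≤ 𝓝[Iio 1 ∪ {1}] 1 := nhdsWithin_mono _ fun y hy ↦ by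
        rcases hy.2.lt_or_eq with h | h
        · exact Or.inl h
        · exact Or.inr h
      refine Tendsto.mono_left ?_ hle
      rw [nhdsWithin_union, nhdsWithin_singleton]
      refine tendsto_sup.2 ⟨hι0.congr' ?_, ?_⟩
      · filter_upwards [self_mem_nhdsWithin] with y hy using (hg_lt hy).symm
      · rw [← hg_one]
        exact tendsto_pure_nhds g 1
  have hιne : ∀ x, ι (B x) ≠ 0 := fun x ↦ inv_ne_zero (hβne _)
  refine ⟨g, hgc, ?_, ?_, ?_, hg_one⟩
  · -- injectivity on `[0, 1]`
    intro x hx y hy hxy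
    by_cases hx1 : x < 1 <;> by_cases hy1 : y < 1
    · rw [hg_lt hx1, hg_lt hy1] at hxy
      have h1 : (ρ x).toNNReal = (ρ y).toNNReal := hβi (hιinj hxy)
      have h2 : ρ x = ρ y := by
        have := congrArg (fun u : ℝ≥0 ↦ (u : ℝ)) h1
        rwa [Real.coe_toNNReal _ (hρnn hx.1 hx1), Real.coe_toNNReal _ (hρnn hy.1 hy1)] at this
      exact hρinj hx1 hy1 h2
    · rw [hg_lt hx1, hg_ge hy1] at hxy
      exact absurd hxy (hιne x)
    · rw [hg_ge hx1, hg_lt hy1] at hxy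
      exact absurd hxy.symm (hιne y)
    · exact (le_antisymm hx.2 (not_lt.1 hx1)).trans (le_antisymm hy.2 (not_lt.1 hy1)).symm
  · -- the image
    ext z
    simp only [mem_image, mem_union, mem_singleton_iff, mem_range]
    constructor
    · rintro ⟨x, hx, rfl⟩
      by_cases hx1 : x < 1
      · left
        exact ⟨B x, ⟨_, rfl⟩, (hg_lt hx1).symm⟩
      · right
        rw [hg_ge hx1]
    · rintro (⟨w, ⟨t, rfl⟩, rfl⟩ | rfl)
      · obtain ⟨x, hx0, hx1, hxt⟩ := hρsurj t t.2
        refine ⟨x, ⟨hx0, hx1.le⟩, ?_⟩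
        rw [hg_lt hx1, hB]
        simp only
        rw [hxt, Real.toNNReal_coe]
      · exact ⟨1, ⟨zero_le_one, le_rfl⟩, hg_one⟩
  · -- `g 0 = ι (β 0)`
    rw [hg_lt one_pos, hB]
    simp [hρ, hι]

end Literature.Probability.RandomPlanarGeometry

namespace Literature.Probability.RandomPlanarGeometry

namespace IsChordalSimplePath

variable {γ : ℝ≥0 → ℂ}

/-- `1` is not on a simple path from `0` to `∞` in `ℍ` (its points off `0` have positive
imaginary part). [folklore] -/
theorem one_notMem_range (h : IsChordalSimplePath γ) : (1 : ℂ) ∉ range γ := by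
  rintro ⟨t, ht⟩
  rcases eq_or_ne t 0 with rfl | h0
  · rw [h.apply_zero] at ht
    exact zero_ne_one ht
  · have := h.im_pos (pos_iff_ne_zero.2 h0)
    rw [ht] at this
    simp at this

/-- The range of a simple path from `0` to `∞` is closed. [folklore] -/
theorem isClosedEmbedding (h : IsChordalSimplePath γ) : IsClosedEmbedding γ :=
  RestrictionConfig.isClosedEmbedding_of_tendsto_norm_atTop h.continuous h.injective h.tendsto_norm

/-- A point of the path and a point of the mirror path coincide only at `0`. [folklore] -/
theorem eq_zero_of_apply_eq_conj (h : IsChordalSimplePath γ) {s u : ℝ≥0}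
    (hsu : γ s = conj (γ u)) : s = 0 := by
  by_contra hs
  have h1 : 0 < (γ s).im := h.im_pos (pos_iff_ne_zero.2 hs)
  have h2 : (γ s).im = -(γ u).im := by rw [hsu, Complex.conj_im]
  have h3 : 0 ≤ (γ u).im := h.im_nonneg u
  linarith

/-- **The mirror double of the path minus a small open arc does not separate the plane**: for
`0 < a < b`, the complement of `γ[b, ∞) ∪ γ[0, a] ∪ conj(γ[0, ∞))` is connected. The inversion
`ι(z) = (z − 1)⁻¹` carries this closed set together with `∞` onto the union of three simple arcs
glued end to end (`isSimpleArc_inv_image_range`, `IsSimpleArc.union`), a Jordan arc, which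
does not separate the plane (`JordanArcSeparation_holds`). [cite: Mccleary2006, Ch. 9, p. 130 (Separation Theorem for Jordan arcs)] -/
theorem isConnected_compl_pieces (h : IsChordalSimplePath γ) {a b : ℝ≥0} (ha : 0 < a) (hab : a < b) :
    IsConnected (γ '' Ici b ∪ (γ '' Icc 0 a ∪ conj ⁻¹' range γ))ᶜ := by
  classical
  set A : Set ℂ := γ '' Ici b ∪ (γ '' Icc 0 a ∪ conj ⁻¹' range γ) with hA
  set ι : ℂ → ℂ := fun z ↦ (z - 1)⁻¹ with hι
  have hιinj : Function.Injective ι := fun z w hzw ↦ sub_left_injective (inv_inj.1 hzw)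
  have hb0 : 0 < b := ha.trans hab
  -- `A` is closed and misses `1`
  have hAcl : IsClosed A := by
    refine (h.isClosedEmbedding.isClosedMap _ isClosed_Ici).union
      ((h.isClosedEmbedding.isClosedMap _ isClosed_Icc).union ?_)
    exact h.isClosedEmbedding.isClosed_range.preimage Complex.continuous_conj
  have h1A : (1 : ℂ) ∉ A := by
    rintro (⟨t, -, ht⟩ | ⟨t, -, ht⟩ | h1)
    · exact h.one_notMem_range ⟨t, ht⟩
    · exact h.one_notMem_range ⟨t, ht⟩
    · exact h.one_notMem_range (by simpa using h1)
  -- the three rays/arcs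
  -- (1) the tail `γ[b, ∞)`
  set β₁ : ℝ≥0 → ℂ := fun t ↦ γ (b + t) with hβ₁
  have hβ₁c : Continuous β₁ := h.continuous.comp (continuous_const.add continuous_id)
  have hβ₁i : Function.Injective β₁ := fun s t hst ↦ add_left_cancel (h.injective hst)
  have hβ₁n : Tendsto (fun t ↦ ‖β₁ t‖) atTop atTop :=
    h.tendsto_norm.comp (Filter.tendsto_atTop_mono (fun t ↦ le_add_self) tendsto_id)
  have hβ₁r : range β₁ = γ '' Ici b := by
    ext z
    constructor
    · rintro ⟨t, rfl⟩
      exact ⟨b + t, show b ≤ b + t from le_self_add, rfl⟩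
    · rintro ⟨t, ht, rfl⟩
      refine ⟨t - b, ?_⟩
      simp only [hβ₁]
      rw [add_tsub_cancel_of_le (mem_Ici.1 ht)]
  have h1β₁ : (1 : ℂ) ∉ range β₁ := fun ⟨t, ht⟩ ↦ h.one_notMem_range ⟨_, ht⟩
  have hΛ₁ : IsSimpleArc (ι '' (γ '' Ici b) ∪ {0}) (ι (γ b)) 0 := by
    have := isSimpleArc_inv_image_range hβ₁c hβ₁i hβ₁n h1β₁
    rw [hβ₁r] at this
    simpa [hβ₁] using this
  -- (3) the mirror path `conj γ[0, ∞)`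
  set β₃ : ℝ≥0 → ℂ := fun t ↦ conj (γ t) with hβ₃
  have hβ₃c : Continuous β₃ := Complex.continuous_conj.comp h.continuous
  have hβ₃i : Function.Injective β₃ := fun s t hst ↦ by
    have : γ s = γ t := by simpa [hβ₃] using congrArg conj hst
    exact h.injective this
  have hβ₃n : Tendsto (fun t ↦ ‖β₃ t‖) atTop atTop := by
    simpa [hβ₃] using h.tendsto_norm
  have hβ₃r : range β₃ = conj ⁻¹' range γ := by
    ext z
    simp only [mem_range, mem_preimage, hβ₃]
    constructor
    · rintro ⟨t, rfl⟩
      exact ⟨t, by simp⟩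
    · rintro ⟨t, ht⟩
      exact ⟨t, by rw [ht, Complex.conj_conj]⟩
  have h1β₃ : (1 : ℂ) ∉ range β₃ := by
    rw [hβ₃r]
    simpa using h.one_notMem_range
  have hι0 : ι 0 = -1 := by simp [hι]
  have hΛ₃ : IsSimpleArc (ι '' (conj ⁻¹' range γ) ∪ {0}) (-1) 0 := by
    have := isSimpleArc_inv_image_range hβ₃c hβ₃i hβ₃n h1β₃
    rw [hβ₃r] at this
    simpa [hβ₃, h.apply_zero, hι] using this
  -- (2) the initial piece `γ[0, a]`
  have hΛ₂ : IsSimpleArc (ι '' (γ '' Icc 0 a)) (-1) (ι (γ a)) := by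
    have hne1 : ∀ x : ℝ, γ (x * a).toNNReal - 1 ≠ 0 := fun x hx ↦
      h.one_notMem_range ⟨_, (sub_eq_zero.1 hx)⟩
    refine ⟨fun x ↦ ι (γ ((x * a : ℝ).toNNReal)), ?_, ?_, ?_, ?_, ?_⟩
    · refine ContinuousOn.inv₀ ?_ fun x _ ↦ hne1 x
      exact ((h.continuous.comp (continuous_real_toNNReal.comp
        (continuous_id.mul continuous_const))).sub continuous_const).continuousOn
    · intro x hx y hy hxy
      have h1 := h.injective (hιinj hxy)
      have h2 : x * a = y * a :=
        (Real.toNNReal_eq_toNNReal_iff (mul_nonneg hx.1 a.2) (mul_nonneg hy.1 a.2)).1 h1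
      have ha' : (0 : ℝ) < a := ha
      exact mul_right_cancel₀ ha'.ne' h2
    · ext z
      simp only [mem_image, mem_Icc, exists_exists_and_eq_and]
      constructor
      · rintro ⟨x, hx, rfl⟩
        refine ⟨(x * a : ℝ).toNNReal, ⟨bot_le, ?_⟩, rfl⟩
        exact Real.toNNReal_le_iff_le_coe.2 (mul_le_of_le_one_left a.2 hx.2)
      · rintro ⟨t, ht, rfl⟩
        have ha' : (0 : ℝ) < a := ha
        refine ⟨(t : ℝ) / a, ⟨div_nonneg t.2 ha'.le, ?_⟩, ?_⟩
        · rw [div_le_one ha']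
          exact_mod_cast ht.2
        · rw [div_mul_cancel₀ _ ha'.ne', Real.toNNReal_coe]
    · simp [h.apply_zero, hι]
    · simp
  -- gluing: `Λ₁ ∪ Λ₃` at `0`, then `∪ Λ₂` at `-1`
  have hglue₁ : (ι '' (γ '' Ici b) ∪ {0}) ∩ (ι '' (conj ⁻¹' range γ) ∪ {0}) ⊆ {0} := by
    rintro z ⟨hz₁, hz₃⟩
    rcases hz₁ with ⟨w₁, ⟨t, ht, rfl⟩, rfl⟩ | rfl
    · rcases hz₃ with ⟨w₃, hw₃, hw⟩ | h0
      · exfalso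
        have heq : w₃ = γ t := hιinj hw
        obtain ⟨u, hu⟩ := mem_preimage.1 hw₃
        have : t = 0 := h.eq_zero_of_apply_eq_conj (u := u) (by rw [← heq, hu, Complex.conj_conj])
        have hbt : b ≤ t := ht
        rw [this] at hbt
        exact absurd hbt (not_le.2 hb0)
      · exact h0
    · rfl
  have harcA : IsSimpleArc ((ι '' (γ '' Ici b) ∪ {0}) ∪ (ι '' (conj ⁻¹' range γ) ∪ {0}))
      (ι (γ b)) (-1) := hΛ₁.union hΛ₃.symm hglue₁
  have hglue₂ : ((ι '' (γ '' Ici b) ∪ {0}) ∪ (ι '' (conj ⁻¹' range γ) ∪ {0})) ∩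
      ι '' (γ '' Icc 0 a) ⊆ {-1} := by
    rintro z ⟨hz, ⟨w₂, ⟨s, hs, rfl⟩, rfl⟩⟩
    have hz0 : ι (γ s) ≠ 0 := inv_ne_zero fun h0 ↦ h.one_notMem_range ⟨s, sub_eq_zero.1 h0⟩
    rcases hz with (⟨w₁, ⟨t, ht, rfl⟩, hw⟩ | h0) | (⟨w₃, hw₃, hw⟩ | h0)
    · exfalso
      have : s = t := h.injective (hιinj hw).symm
      have hbt : b ≤ t := ht
      rw [← this] at hbt
      exact absurd (hs.2.trans_lt hab) (not_lt.2 hbt)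
    · exact absurd h0 hz0
    · obtain ⟨u, hu⟩ := mem_preimage.1 hw₃
      have heq : γ s = w₃ := hιinj hw.symm
      have hs0 : s = 0 := h.eq_zero_of_apply_eq_conj (u := u) (by rw [heq, hu, Complex.conj_conj])
      rw [mem_singleton_iff, hs0, h.apply_zero, hι0]
    · exact absurd h0 hz0
  have harc : IsSimpleArc (((ι '' (γ '' Ici b) ∪ {0}) ∪ (ι '' (conj ⁻¹' range γ) ∪ {0})) ∪
      ι '' (γ '' Icc 0 a)) (ι (γ b)) (ι (γ a)) := harcA.union hΛ₂ hglue₂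
  -- the glued arc is `ι(A) ∪ {0}`
  set Λ : Set ℂ := ι '' A ∪ {0} with hΛ
  have hΛeq : ((ι '' (γ '' Ici b) ∪ {0}) ∪ (ι '' (conj ⁻¹' range γ) ∪ {0})) ∪
      ι '' (γ '' Icc 0 a) = Λ := by
    simp only [hΛ, hA, image_union]
    ext z
    simp only [mem_union, mem_singleton_iff]
    tauto
  rw [hΛeq] at harc
  obtain ⟨e, -, -⟩ := harc.exists_homeomorph
  have hΛconn : IsConnected Λᶜ := JordanArcSeparation_holds Λ ⟨e⟩
  -- transfer back through `w ↦ w⁻¹ + 1`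
  have hzero : (0 : ℂ) ∈ Λ := Or.inr rfl
  have hkey : ∀ {z : ℂ}, z ≠ 1 → (z ∉ A ↔ ι z ∉ Λ) := by
    intro z hz1
    have hιz : ι z ≠ 0 := inv_ne_zero (sub_ne_zero.2 hz1)
    simp only [hΛ, mem_union, mem_singleton_iff, hιz, or_false, hιinj.mem_set_image]
  have himage : (fun w ↦ w⁻¹ + 1) '' Λᶜ = Aᶜ \ {1} := by
    ext z
    constructor
    · rintro ⟨w, hw, rfl⟩
      have hw0 : w ≠ 0 := fun h0 ↦ hw (h0 ▸ hzero)
      have hzc : w⁻¹ + 1 ≠ (1 : ℂ) := by simpa using inv_ne_zero hw0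
      have hιz : ι (w⁻¹ + 1) = w := by simp [hι]
      exact ⟨(hkey hzc).2 (hιz.symm ▸ hw), hzc⟩
    · rintro ⟨hzA, hz1⟩
      refine ⟨ι z, (hkey hz1).1 hzA, ?_⟩
      simp [hι]
  have hconn : IsConnected (Aᶜ \ {1}) := by
    rw [← himage]
    refine hΛconn.image _ ((continuousOn_inv₀.mono ?_).add continuousOn_const)
    intro w hw h0
    exact hw ((show w = 0 from h0) ▸ hzero)
  -- put back the point `1`
  refine ⟨⟨1, h1A⟩, hconn.isPreconnected.subset_closure Set.sdiff_subset ?_⟩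
  intro z hz
  by_cases hz1 : z = 1
  · subst hz1
    rw [mem_closure_iff_nhds]
    intro U hU
    have hmem : {(1 : ℂ)}ᶜ ∩ (U ∩ Aᶜ) ∈ 𝓝[≠] (1 : ℂ) :=
      inter_mem_nhdsWithin _ (inter_mem hU (hAcl.isOpen_compl.mem_nhds hz))
    obtain ⟨w, hw1, hwU, hwA⟩ := Filter.nonempty_of_mem hmem
    exact ⟨w, hwU, hwA, hw1⟩
  · exact subset_closure ⟨hz, hz1⟩


/-- **Every point of a simple path from `0` to `∞` in `ℍ` is a limit of points to its right**:
`γ(t₀) ∈ cl(rightDomain)` for `t₀ > 0` (the frontier half of the Jordan curve theorem for the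
curve `γ ∪ conj γ` through `∞`). Proof: remove the small open arc `γ(t₀ − δ, t₀ + δ)` from the
mirror double `F* = γ[0, ∞) ∪ conj γ[0, ∞)`; the rest does not separate the plane
(`isConnected_compl_pieces`), so `1` is joined to `−1` by a path missing it; the path meets `F*`
(`−1` is not to the right of the path, `RestrictionConfig.neg_one_notMem_rightDomain`), first at
a point of the small arc, which is therefore a limit of points of the right domain.
[cite: Mccleary2006, Ch. 9, p. 129 (The Jordan Curve Theorem: each component shares C as boundary)] -/
theorem mem_closure_rightDomain (h : IsChordalSimplePath γ) {t₀ : ℝ≥0} (ht₀ : 0 < t₀) :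
    γ t₀ ∈ closure h.toConfig.rightDomain := by
  classical
  set K := h.toConfig with hK
  have hF : K.mirrorClosure = range γ ∪ conj ⁻¹' range γ := by
    show closure (K : Set ℂ) ∪ conj ⁻¹' closure (K : Set ℂ) = _
    rw [h.closure_coe_toConfig]
  have hFcl : IsClosed K.mirrorClosure := K.isClosed_mirrorClosure
  rw [Metric.mem_closure_iff]
  intro ε hε
  obtain ⟨δ₁, hδ₁, hclose⟩ := Metric.continuous_iff.1 h.continuous t₀ (ε / 2) (half_pos hε)
  -- a parameter window `(a, b) = (t₀ - δ, t₀ + δ)` mapped into the `ε/2`-ball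
  have ht₀' : (0 : ℝ) < t₀ := ht₀
  set d : ℝ := min ((t₀ : ℝ) / 2) (δ₁ / 2) with hd
  have hd0 : 0 < d := lt_min (by positivity) (by positivity)
  have hdt : d < t₀ := (min_le_left _ _).trans_lt (by linarith)
  have hd1 : d < δ₁ := (min_le_right _ _).trans_lt (by linarith)
  set δ : ℝ≥0 := ⟨d, hd0.le⟩ with hδ
  have hδ0 : 0 < δ := hd0
  have hδt : δ < t₀ := by
    rw [← NNReal.coe_lt_coe]
    exact hdt
  set a : ℝ≥0 := t₀ - δ with ha
  set b : ℝ≥0 := t₀ + δ with hb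
  have ha0 : 0 < a := tsub_pos_of_lt hδt
  have hab : a < b := (tsub_le_self).trans_lt (lt_add_of_pos_right _ hδ0)
  have hwin : ∀ t : ℝ≥0, a < t → t < b → dist (γ t) (γ t₀) < ε / 2 := by
    intro t hat htb
    apply hclose
    rw [NNReal.dist_eq, abs_sub_lt_iff]
    have h1 : ((a : ℝ≥0) : ℝ) = t₀ - δ := NNReal.coe_sub hδt.le
    have h2 : ((b : ℝ≥0) : ℝ) = t₀ + δ := NNReal.coe_add _ _
    have hat' : ((a : ℝ≥0) : ℝ) < t := hat
    have htb' : (t : ℝ) < b := htb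
    rw [h1] at hat'
    rw [h2] at htb'
    have hδd : ((δ : ℝ≥0) : ℝ) = d := rfl
    constructor <;> linarith
  -- the closed set `A = F* ∖ γ(a, b)`
  set A : Set ℂ := γ '' Ici b ∪ (γ '' Icc 0 a ∪ conj ⁻¹' range γ) with hA
  have hconn : IsConnected Aᶜ := h.isConnected_compl_pieces ha0 hab
  have hAcl : IsClosed A := by
    refine (h.isClosedEmbedding.isClosedMap _ isClosed_Ici).union
      ((h.isClosedEmbedding.isClosedMap _ isClosed_Icc).union ?_)
    exact h.isClosedEmbedding.isClosed_range.preimage Complex.continuous_conj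
  have hAF : A ⊆ K.mirrorClosure := by
    rw [hF]
    rintro z (⟨t, -, rfl⟩ | ⟨t, -, rfl⟩ | hz)
    · exact Or.inl (mem_range_self t)
    · exact Or.inl (mem_range_self t)
    · exact Or.inr hz
  have hFA : ∀ z ∈ K.mirrorClosure, z ∉ A → ∃ t, a < t ∧ t < b ∧ γ t = z := by
    intro z hz hzA
    rw [hF] at hz
    rcases hz with ⟨t, rfl⟩ | hz
    · refine ⟨t, ?_, ?_, rfl⟩
      · by_contra hta
        exact hzA (Or.inr (Or.inl ⟨t, ⟨bot_le, not_lt.1 hta⟩, rfl⟩))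
      · by_contra htb
        exact hzA (Or.inl ⟨t, not_lt.1 htb, rfl⟩)
    · exact absurd (Or.inr (Or.inr hz)) hzA
  have h1A : (1 : ℂ) ∉ A := fun h1 ↦ K.one_notMem_mirrorClosure (hAF h1)
  have hm1A : (-1 : ℂ) ∉ A := fun h1 ↦ K.neg_one_notMem_mirrorClosure (hAF h1)
  -- a path from `1` to `-1` off `A`
  have hpc : IsPathConnected Aᶜ := (hAcl.isOpen_compl.isConnected_iff_isPathConnected).1 hconn
  obtain ⟨p, hp⟩ := hpc.joinedIn 1 h1A (-1) hm1A
  set η : ℝ → ℂ := ⇑p.extend with hη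
  have hηc : Continuous η := p.extend.continuous
  have hηmem : ∀ {u : ℝ}, u ∈ Icc (0 : ℝ) 1 → η u ∉ A := fun {u} hu ↦ by
    rw [hη, p.extend_apply hu]
    exact hp _
  have hη0 : η 0 = 1 := p.extend_zero
  have hη1 : η 1 = -1 := p.extend_one
  -- the path meets `F*`: otherwise `-1` would be to the right of the path
  set S : Set ℝ := {u | u ∈ Icc (0 : ℝ) 1 ∧ η u ∈ K.mirrorClosure} with hS
  have hScl : IsClosed S := by
    have : S = Icc (0 : ℝ) 1 ∩ η ⁻¹' K.mirrorClosure := by ext u; simp [hS]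
    rw [this]
    exact isClosed_Icc.inter (hFcl.preimage hηc)
  have hSne : S.Nonempty := by
    by_contra hSe
    rw [not_nonempty_iff_eq_empty] at hSe
    have hsub : η '' Icc 0 1 ⊆ K.mirrorClosureᶜ := by
      rintro _ ⟨u, hu, rfl⟩ hF'
      have : u ∈ S := ⟨hu, hF'⟩
      rw [hSe] at this
      exact this
    have hT : IsPreconnected (η '' Icc 0 1) := isPreconnected_Icc.image η hηc.continuousOn
    have h1T : (1 : ℂ) ∈ η '' Icc 0 1 := ⟨0, ⟨le_rfl, zero_le_one⟩, hη0⟩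
    have hsubR : η '' Icc 0 1 ⊆ K.rightDomain := hT.subset_connectedComponentIn h1T hsub
    have : (-1 : ℂ) ∈ K.rightDomain := hsubR ⟨1, ⟨zero_le_one, le_rfl⟩, hη1⟩
    exact K.neg_one_notMem_rightDomain this
  have hSbdd : BddBelow S := ⟨0, fun u hu ↦ hu.1.1⟩
  set u₁ : ℝ := sInf S with hu₁
  have hu₁S : u₁ ∈ S := hScl.csInf_mem hSne hSbdd
  have hu₁pos : 0 < u₁ := by
    rcases hu₁S.1.1.eq_or_lt with h0 | h0
    · exfalso
      have := hu₁S.2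
      rw [← h0, hη0] at this
      exact K.one_notMem_mirrorClosure this
    · exact h0
  have hbefore : ∀ u ∈ Ico (0 : ℝ) u₁, η u ∉ K.mirrorClosure := by
    intro u hu huF
    have : u₁ ≤ u := csInf_le hSbdd ⟨⟨hu.1, hu.2.le.trans hu₁S.1.2⟩, huF⟩
    linarith [hu.2]
  -- the first hit `w = η u₁` is a limit of points of the right domain
  set w : ℂ := η u₁ with hw
  have hT : IsPreconnected (η '' Ico 0 u₁) := isPreconnected_Ico.image η hηc.continuousOn
  have hTsub : η '' Ico 0 u₁ ⊆ K.mirrorClosureᶜ := by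
    rintro _ ⟨u, hu, rfl⟩
    exact hbefore u hu
  have h1T : (1 : ℂ) ∈ η '' Ico 0 u₁ := ⟨0, ⟨le_rfl, hu₁pos⟩, hη0⟩
  have hTR : η '' Ico 0 u₁ ⊆ K.rightDomain := hT.subset_connectedComponentIn h1T hTsub
  have hwcl : w ∈ closure K.rightDomain := by
    refine closure_mono hTR (map_mem_closure (f := η) hηc ?_ (mapsTo_image η (Ico 0 u₁)))
    rw [closure_Ico hu₁pos.ne]
    exact ⟨hu₁pos.le, le_rfl⟩
  -- and it lies on the small arc
  have hwA : w ∉ A := hηmem hu₁S.1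
  obtain ⟨t, hat, htb, htw⟩ := hFA w hu₁S.2 hwA
  have hdist : dist w (γ t₀) < ε / 2 := by
    rw [← htw]
    exact hwin t hat htb
  obtain ⟨w', hw'R, hww'⟩ := Metric.mem_closure_iff.1 hwcl (ε / 2) (half_pos hε)
  refine ⟨w', hw'R, ?_⟩
  calc dist (γ t₀) w' ≤ dist (γ t₀) w + dist w w' := dist_triangle _ _ _
    _ < ε / 2 + ε / 2 := by rw [dist_comm]; exact add_lt_add hdist hww'
    _ = ε := by ring

/-- **… and of points to its left**: `γ(t₀) ∈ cl(leftDomain)` for `t₀ > 0`, by reflection in the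
imaginary axis (`toConfig_negConj`, `RestrictionConfig.rightDomain_reflect`).
[cite: Mccleary2006, Ch. 9, p. 129 (The Jordan Curve Theorem: each component shares C as boundary)] -/
theorem mem_closure_leftDomain (h : IsChordalSimplePath γ) {t₀ : ℝ≥0} (ht₀ : 0 < t₀) :
    γ t₀ ∈ closure h.toConfig.leftDomain := by
  have h1 := h.negConj.mem_closure_rightDomain ht₀
  rw [h.toConfig_negConj, RestrictionConfig.rightDomain_reflect, ← imagAxisRefl.image_closure] at h1
  obtain ⟨z, hz, hzeq⟩ := h1
  have : z = γ t₀ := by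
    have := congrArg imagAxisRefl hzeq
    rw [imagAxisRefl_imagAxisRefl] at this
    rw [this]
    simp [imagAxisRefl_apply]
  rwa [← this]

end IsChordalSimplePath

/-- **A point of a simple-curve configuration is a limit of points strictly to its right**
(`K ⊆ cl(rightDomain K)` for `K ∈ Ω` a simple path). [cite: Mccleary2006, Ch. 9, p. 129 (The Jordan Curve Theorem)] -/
theorem RestrictionConfig.IsSimplePath.mem_closure_rightDomain {K : RestrictionConfig}
    (hK : K.IsSimplePath) {z : ℂ} (hz : z ∈ (K : Set ℂ)) : z ∈ closure K.rightDomain := by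
  obtain ⟨γ, hγc, hγi, hγ0, hγn, hKγ⟩ := hK
  have h : IsChordalSimplePath γ := by
    refine ⟨hγc, ⟨hγi, fun t ht ↦ ?_⟩, hγ0, hγn⟩
    have : γ t ∈ (K : Set ℂ) := by
      rw [hKγ]
      exact ⟨t, ht, rfl⟩
    exact K.subset_upperHalfPlaneSet this
  have hKeq : h.toConfig = K := Subtype.ext (by rw [IsChordalSimplePath.coe_toConfig, ← hKγ])
  rw [hKγ] at hz
  obtain ⟨t, ht, rfl⟩ := hz
  rw [← hKeq]
  exact h.mem_closure_rightDomain ht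

/-! ### Measurable events: `i ∈ cl(rightDomain K)` on `Ω`; `z ∈ K'`, `i ∈ int K'` on `Ω₊`

(`i ∈ K` on `Ω` is the tree's `RestrictionConfig.measurableSet_mem`.) -/

section Events

open MeasureTheory

/-- `i ∈ ℍ`. [folklore] -/
private theorem I_mem_H : (Complex.I : ℂ) ∈ upperHalfPlaneSet := by
  show 0 < Complex.I.im
  simp

/-- A point within distance `1` of `i` lies in `ℍ`. [folklore] -/
private theorem im_pos_of_dist_I_lt_one {q : ℂ} (hq : dist q Complex.I < 1) : 0 < q.im := by
  have h1 : |(q - Complex.I).im| ≤ ‖q - Complex.I‖ := Complex.abs_im_le_norm _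
  rw [dist_eq_norm] at hq
  have h2 : |q.im - 1| < 1 := by
    have : (q - Complex.I).im = q.im - 1 := by simp
    rw [this] at h1
    exact h1.trans_lt hq
  rw [abs_sub_lt_iff] at h2
  linarith [h2.2]

/-- `1/(n+2) < 1`. [folklore] -/
private theorem one_div_nat_add_two_lt_one (n : ℕ) : (1 : ℝ) / (n + 2) < 1 := by
  rw [div_lt_one (by positivity)]
  have : (0 : ℝ) ≤ n := n.cast_nonneg
  linarith

namespace RestrictionConfig

/-- **`{K ∈ Ω : i ∈ K} = (rightOf i ∪ σ⁻¹ rightOf i)ᶜ`**: a point of `ℍ` off `K` is strictly to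
the right or strictly to the left of `K` (`mem_rightDomain_or_mem_leftDomain`), and a point of
`K ⊆ F*` is in neither side domain. [cite: LawlerSchrammWerner2003Restriction, proof of Cor. 8.6 (p. 38)] -/
theorem setOf_I_mem_eq :
    {K : RestrictionConfig | Complex.I ∈ (K : Set ℂ)} = (rightOf Complex.I ∪ reflect ⁻¹' rightOf Complex.I)ᶜ := by
  ext K
  rw [reflect_preimage_rightOf_I]
  simp only [mem_setOf_eq, mem_compl_iff, mem_union, mem_rightOf, not_or]
  constructor
  · intro hI
    have hF : Complex.I ∈ K.mirrorClosure := K.closure_subset_mirrorClosure (subset_closure hI)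
    exact ⟨fun h ↦ K.rightDomain_subset_compl h hF, fun h ↦ K.leftDomain_subset_compl h hF⟩
  · rintro ⟨h1, h2⟩
    by_contra hI
    rcases K.mem_rightDomain_or_mem_leftDomain (z := Complex.I) (by simp) hI with h | h
    exacts [h1 h, h2 h]

/-- **The event "`i` is a limit of points strictly to the right of `K`" is measurable**: with a
countable dense set of test points `q` near `i`, `i ∈ cl(rightDomain K)` iff for every `n` some
`q` with `|q − i| < 1/(n+1)` is to the right of `K` (the right domain is open). [folklore] -/
theorem measurableSet_setOf_I_mem_closure_rightDomain :
    MeasurableSet {K : RestrictionConfig | Complex.I ∈ closure K.rightDomain} := by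
  obtain ⟨D, hDc, hDd⟩ := TopologicalSpace.exists_countable_dense ℂ
  have key : {K : RestrictionConfig | Complex.I ∈ closure K.rightDomain} =
      ⋂ n : ℕ, ⋃ q ∈ {q : ℂ | q ∈ D ∧ dist q Complex.I < 1 / (n + 2)}, rightOf q := by
    ext K
    simp only [mem_setOf_eq, mem_iInter, mem_iUnion, mem_rightOf, exists_prop]
    constructor
    · intro hK n
      obtain ⟨w, hwR, hw⟩ := Metric.mem_closure_iff.1 hK (1 / (n + 2)) (by positivity)
      have hopen : IsOpen (ball Complex.I (1 / (n + 2)) ∩ K.rightDomain) :=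
        isOpen_ball.inter K.isOpen_rightDomain
      obtain ⟨q, hqD, hqball, hqR⟩ :=
        hDd.exists_mem_open hopen ⟨w, by rwa [mem_ball, dist_comm], hwR⟩
      exact ⟨q, ⟨hqD, mem_ball.1 hqball⟩, hqR⟩
    · intro hK
      rw [Metric.mem_closure_iff]
      intro ε hε
      obtain ⟨n, hn⟩ := exists_nat_one_div_lt hε
      obtain ⟨q, ⟨-, hq⟩, hqR⟩ := hK n
      refine ⟨q, hqR, ?_⟩
      rw [dist_comm]
      have : (1 : ℝ) / (n + 2) ≤ 1 / (n + 1) := by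
        gcongr
        linarith
      linarith
  rw [key]
  refine MeasurableSet.iInter fun n ↦ MeasurableSet.biUnion (hDc.mono fun q hq ↦ hq.1) fun q hq ↦ ?_
  exact measurableSet_rightOf (im_pos_of_dist_I_lt_one (hq.2.trans (one_div_nat_add_two_lt_one n)))

end RestrictionConfig

namespace RightConfig

/-- The event `{K' ∈ Ω₊ : z ∈ K'}` is measurable for `z ∈ ℍ` (`measurableSet_notMem`). [folklore] -/
theorem measurableSet_setOf_mem {z : ℂ} (hz : z ∈ upperHalfPlaneSet) :
    MeasurableSet {K : RightConfig | z ∈ (K : Set ℂ)} := by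
  have h := (measurableSet_notMem hz).compl
  have heq : {K : RightConfig | z ∉ (K : Set ℂ)}ᶜ = {K : RightConfig | z ∈ (K : Set ℂ)} := by
    ext K
    simp
  rwa [heq] at h

/-- **The event "`i` is an interior point of `K'`" is measurable on `Ω₊`**: `K'` being closed,
`i ∈ int K'` iff for some `n` every test point of a countable dense set within `1/(n+2)` of `i`
lies in `K'`. [folklore] -/
theorem measurableSet_setOf_I_mem_interior :
    MeasurableSet {K : RightConfig | Complex.I ∈ interior (K : Set ℂ)} := by
  obtain ⟨D, hDc, hDd⟩ := TopologicalSpace.exists_countable_dense ℂ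
  have key : {K : RightConfig | Complex.I ∈ interior (K : Set ℂ)} =
      ⋃ n : ℕ, ⋂ q ∈ {q : ℂ | q ∈ D ∧ dist q Complex.I < 1 / (n + 2)},
        {K : RightConfig | q ∈ (K : Set ℂ)} := by
    ext K
    simp only [mem_setOf_eq, mem_iUnion, mem_iInter]
    constructor
    · intro hK
      obtain ⟨r, hr, hball⟩ := Metric.isOpen_iff.1 isOpen_interior Complex.I hK
      obtain ⟨n, hn⟩ := exists_nat_one_div_lt hr
      refine ⟨n, fun q hq ↦ interior_subset (hball (mem_ball.2 (hq.2.trans (lt_trans ?_ hn))))⟩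
      gcongr
      linarith
    · rintro ⟨n, hn⟩
      have hsub : ball Complex.I (1 / (n + 2)) ⊆ (K : Set ℂ) := by
        refine (hDd.open_subset_closure_inter isOpen_ball).trans (closure_minimal ?_ K.isClosed)
        rintro q ⟨hq, hqD⟩
        exact hn q ⟨hqD, mem_ball.1 hq⟩
      exact mem_interior.2 ⟨_, hsub, isOpen_ball, mem_ball_self (by positivity)⟩
  rw [key]
  refine MeasurableSet.iUnion fun n ↦ MeasurableSet.biInter (hDc.mono fun q hq ↦ hq.1) fun q hq ↦ ?_
  exact measurableSet_setOf_mem (im_pos_of_dist_I_lt_one (hq.2.trans (one_div_nat_add_two_lt_one n)))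

/-- **A right-boundary point of `F(K₁ ∪ K₂)` lies on `K₁ ∪ K₂`**: a point of `ℍ` in the filled
union but not interior to it is a limit of points of the component of `[0, ∞)` in
`ℍ̄ ∖ (K₁ ∪ K₂)`; were it off the closed set `K₁ ∪ K₂`, a half-ball around it would lie in one
component of `ℍ̄ ∖ (K₁ ∪ K₂)` (`exists_ball_inter_subset_connectedComponentIn`), which would
then be that of `[0, ∞)`, putting the point outside the filling. [folklore] -/
theorem mem_union_of_mem_fillUnion_of_notMem_interior (K₁ K₂ : RightConfig) {z : ℂ}
    (hz : 0 < z.im) (hzF : z ∈ (fillUnion K₁ K₂ : Set ℂ))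
    (hzint : z ∉ interior (fillUnion K₁ K₂ : Set ℂ)) : z ∈ (K₁ : Set ℂ) ∪ K₂ := by
  by_contra hzA
  rw [interior_eq_compl_closure_compl, mem_compl_iff, not_not, coe_fillUnion] at hzint
  rw [coe_fillUnion] at hzF
  have hzmem : z ∈ connectedComponentIn ({w : ℂ | 0 ≤ w.im} \ ((K₁ : Set ℂ) ∪ K₂)) z :=
    mem_connectedComponentIn ⟨hz.le, hzA⟩
  obtain ⟨r, hr, hball⟩ :=
    exists_ball_inter_subset_connectedComponentIn (isClosed_union K₁ K₂) hzmem
  obtain ⟨w, hw, hwz⟩ := Metric.mem_closure_iff.1 hzint (min r z.im) (lt_min hr hz)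
  have hwr : dist w z < r := by rw [dist_comm]; exact hwz.trans_le (min_le_left _ _)
  have hwim : 0 < w.im := by
    have h1 : |(z - w).im| ≤ ‖z - w‖ := Complex.abs_im_le_norm _
    rw [← dist_eq_norm] at h1
    have h2 : (z - w).im = z.im - w.im := by simp
    rw [h2] at h1
    have h3 := (le_abs_self _).trans h1
    linarith [hwz.trans_le (min_le_right r z.im)]
  rw [mem_compl_iff, mem_leftFilling_iff, not_and] at hw
  have hw' := hw hwim.le
  push Not at hw'
  obtain ⟨x, hx, hwx⟩ := hw'
  have hwz' : w ∈ connectedComponentIn ({w : ℂ | 0 ≤ w.im} \ ((K₁ : Set ℂ) ∪ K₂)) z :=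
    hball ⟨mem_ball.2 hwr, hwim.le⟩
  have heq : connectedComponentIn ({w : ℂ | 0 ≤ w.im} \ ((K₁ : Set ℂ) ∪ K₂)) (x : ℂ) =
      connectedComponentIn ({w : ℂ | 0 ≤ w.im} \ ((K₁ : Set ℂ) ∪ K₂)) z := by
    rw [connectedComponentIn_eq hwx, ← connectedComponentIn_eq hwz']
  exact (mem_leftFilling_iff.1 hzF).2 x hx (heq ▸ hzmem)

end RightConfig

namespace RestrictionConfig

/-- **`(F^{ℝ₊}_ℍ)⁻¹{i ∈ K'} = (rightOf i)ᶜ`.** [folklore] -/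
theorem leftFillConfig_preimage_setOf_I_mem :
    leftFillConfig ⁻¹' {K' : RightConfig | Complex.I ∈ (K' : Set ℂ)} = (rightOf Complex.I)ᶜ := by
  rw [← leftFillConfig_preimage_setOf_notMem (z := Complex.I) (by simp), ← preimage_compl]
  congr 1
  ext K
  simp

/-- **`(F^{ℝ₊}_ℍ)⁻¹{i ∉ int K'} = {i ∈ cl(rightDomain K)}`**: `Fill₋(cl K) = ℍ̄ ∖ rightDomain K`, so
`i` fails to be interior to the filling iff it is a limit of points of the lower half-plane or
of the right domain, i.e. of the right domain. [folklore] -/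
theorem leftFillConfig_preimage_setOf_I_notMem_interior :
    leftFillConfig ⁻¹' {K' : RightConfig | Complex.I ∉ interior (K' : Set ℂ)} =
      {K : RestrictionConfig | Complex.I ∈ closure K.rightDomain} := by
  ext K
  simp only [mem_preimage, mem_setOf_eq, coe_leftFillConfig]
  rw [interior_eq_compl_closure_compl, mem_compl_iff, not_not]
  have hc : (K.leftFill)ᶜ = {z : ℂ | z.im < 0} ∪ K.rightDomain := by
    ext z
    simp only [leftFill, mem_compl_iff, Set.mem_sdiff, mem_setOf_eq, not_and, not_not, mem_union]
    constructor
    · intro h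
      by_cases hz : 0 ≤ z.im
      · exact Or.inr (h hz)
      · exact Or.inl (not_le.1 hz)
    · rintro (h | h) hz
      · exact absurd hz (not_le.2 h)
      · exact h
  rw [hc, closure_union, Complex.closure_setOf_im_lt]
  constructor
  · rintro (h | h)
    · exfalso
      have : Complex.I.im ≤ 0 := h
      norm_num at this
    · exact h
  · exact fun h ↦ Or.inr h

/-- **A configuration whose left filling has `i` as a non-interior point contains `i`**:
then `i ∉ rightDomain K` but `i ∈ cl(rightDomain K)`, so `i` is a frontier point of the component
`rightDomain K` of `ℂ ∖ F*`, hence in `F* ∩ ℍ = K`. [folklore] -/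
theorem I_mem_of_leftFill {K : RestrictionConfig} (h1 : Complex.I ∈ K.leftFill)
    (h2 : Complex.I ∉ interior K.leftFill) : Complex.I ∈ (K : Set ℂ) := by
  have hR : Complex.I ∉ K.rightDomain := fun h ↦ (K.notMem_leftFill_iff (by simp)).2 h h1
  have hcl : Complex.I ∈ closure K.rightDomain := by
    have : K ∈ leftFillConfig ⁻¹' {K' : RightConfig | Complex.I ∉ interior (K' : Set ℂ)} := h2
    rwa [leftFillConfig_preimage_setOf_I_notMem_interior] at this
  have hfr : Complex.I ∈ frontier K.rightDomain := by
    rw [frontier, K.isOpen_rightDomain.interior_eq]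
    exact ⟨hcl, hR⟩
  have hF : Complex.I ∈ K.mirrorClosure :=
    Literature.Topology.PlaneTopology.Janiszewski.frontier_connectedComponentIn_subset
      K.isClosed_mirrorClosure 1 hfr
  have hclK : Complex.I ∈ closure (K : Set ℂ) := (K.mem_mirrorClosure_iff_of_im_nonneg (by simp)).1 hF
  have h := K.closure_inter_eq
  rw [← h]
  exact ⟨hclK, I_mem_H⟩

end RestrictionConfig

end Events

/-! ### The α > 5/8 half of [LSW] p. 5 result 2 from one-sided restriction measures -/

section Core

open MeasureTheory RestrictionConfig

/-- **`2 · P_α(i is to the right of K) + P_α(i ∈ K) = 1`** for every two-sided restriction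
measure ([LSW] proof of Cor. 8.6, p. 38: "the `P_α` probability that `i` ends up to the 'right'
of `K` is at most `1/2` (it can be smaller if `K` is of positive Lebesgue measure)"): `Ω` is the
disjoint union of "`i` right of `K`", its mirror image "`i` left of `K`" (`setOf_I_mem_eq`) and
"`i ∈ K`", and `P_α` is `σ`-invariant. [cite: LawlerSchrammWerner2003Restriction, proof of Cor. 8.6 (p. 38)] -/
theorem IsRestrictionMeasure.two_mul_measure_rightOf_I_add {α : ℝ} {P : Measure RestrictionConfig}
    (h : IsRestrictionMeasure α P) :
    2 * P (rightOf Complex.I) + P {K : RestrictionConfig | Complex.I ∈ (K : Set ℂ)} = 1 := by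
  haveI := h.isProbabilityMeasure
  have hR : MeasurableSet (rightOf Complex.I) := measurableSet_rightOf (by simp)
  have hL : MeasurableSet (reflect ⁻¹' rightOf Complex.I) := measurable_reflect hR
  have hdisj : Disjoint (rightOf Complex.I) (reflect ⁻¹' rightOf Complex.I) :=
    disjoint_rightOf_I_reflect_preimage
  rw [two_mul, setOf_I_mem_eq]
  calc P (rightOf Complex.I) + P (rightOf Complex.I) + P (rightOf Complex.I ∪ reflect ⁻¹' rightOf Complex.I)ᶜ
      = P (rightOf Complex.I) + P (reflect ⁻¹' rightOf Complex.I) +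
          P (rightOf Complex.I ∪ reflect ⁻¹' rightOf Complex.I)ᶜ := by
        rw [h.measure_preimage_reflect hR]
    _ = P (rightOf Complex.I ∪ reflect ⁻¹' rightOf Complex.I) +
          P (rightOf Complex.I ∪ reflect ⁻¹' rightOf Complex.I)ᶜ := by
        rw [measure_union hdisj hL]
    _ = 1 := prob_add_prob_compl (hR.union hL)

/-- **`P_{5/8}(i ∈ K) = 0`**: `P_{5/8}` is the law of the SLE_{8/3} curve
(`IsRestrictionMeasure.exists_eq_map_sleTrace_eightThirds`, [LSW] Thm. 6.1), which almost surely
misses the point `i` (Rohde–Schramm 2005, Thm. 6.4, `ae_notMem_range_sleTrace_of_lt_eight`).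
[cite: RohdeSchramm2005, Thm 6.4] -/
theorem IsRestrictionMeasure.measure_setOf_I_mem_eq_zero_of_five_eighths {P : Measure RestrictionConfig}
    (hP : IsRestrictionMeasure (5 / 8) P) :
    P {K : RestrictionConfig | Complex.I ∈ (K : Set ℂ)} = 0 := by
  obtain ⟨Kc, hKc, hae, rfl⟩ := hP.exists_eq_map_sleTrace_eightThirds
  rw [Measure.map_apply hKc (RestrictionConfig.measurableSet_mem Complex.I)]
  have h83 : (0 : ℝ≥0) < 8 / 3 := by positivity
  have h83' : (8 : ℝ≥0) / 3 < 8 := by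
    rw [div_lt_iff₀ (by norm_num : (0 : ℝ≥0) < 3)]
    norm_num
  have hIim : 0 < Complex.I.im := by simp
  have h1 : ∀ᵐ ω ∂Process.preWienerMeasure, Complex.I ∉ range (sleTrace ((8 : ℝ≥0) / 3) ω) :=
    ae_notMem_range_sleTrace_of_lt_eight h83 h83' hIim
  rw [measure_eq_zero_iff_ae_notMem]
  filter_upwards [h1, hae] with ω hω1 hω2
  intro hmem
  have hmem' : Complex.I ∈ ((Kc ω : RestrictionConfig) : Set ℂ) := hmem
  rw [hω2.2] at hmem'
  exact hω1 (image_subset_range _ _ hmem')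

/-- The right-boundary event pulled back along `F(K₁ ∪ K₂)`: `i` on the right boundary of the
filled union is on the right boundary of `K₁` or of `K₂`
(`RightConfig.mem_union_of_mem_fillUnion_of_notMem_interior`). [folklore] -/
private theorem fillUnion_preimage_bd_subset :
    (fun p : RightConfig × RightConfig ↦ RightConfig.fillUnion p.1 p.2) ⁻¹'
        {K : RightConfig | Complex.I ∈ (K : Set ℂ) ∧ Complex.I ∉ interior (K : Set ℂ)} ⊆
      {K : RightConfig | Complex.I ∈ (K : Set ℂ) ∧ Complex.I ∉ interior (K : Set ℂ)} ×ˢ univ ∪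
        univ ×ˢ {K : RightConfig | Complex.I ∈ (K : Set ℂ) ∧ Complex.I ∉ interior (K : Set ℂ)} := by
  rintro ⟨K₁, K₂⟩ ⟨hI, hint⟩
  have hmem := RightConfig.mem_union_of_mem_fillUnion_of_notMem_interior K₁ K₂ (by simp) hI hint
  rcases hmem with h | h
  · exact Or.inl ⟨⟨h, fun h' ↦ hint (interior_mono (RightConfig.subset_fillUnion_left K₁ K₂) h')⟩,
      mem_univ _⟩
  · exact Or.inr ⟨mem_univ _,
      ⟨h, fun h' ↦ hint (interior_mono (RightConfig.subset_fillUnion_right K₁ K₂) h')⟩⟩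

/-- **"`i` is interior to the `P⁺_β`-sample with positive probability" propagates upwards in the
exponent**: `P⁺_{β'} = F(P⁺_β ⊗ P⁺_{β'−β})` ([LSW] §8.2 with the uniqueness of §8.1) and
`int K₁ ⊆ int F(K₁ ∪ K₂)`. [cite: LawlerSchrammWerner2003Restriction, §8.2 (sentence preceding Prop. 8.2) with §8.1 (uniqueness of P⁺_α)] -/
theorem IsRightRestrictionMeasure.measure_I_mem_interior_ne_zero_mono {β β' : ℝ}
    {Qβ Qβ' : Measure RightConfig} (hQβ : IsRightRestrictionMeasure β Qβ)
    (hQβ' : IsRightRestrictionMeasure β' Qβ') (hββ' : β ≤ β')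
    (hex : β < β' → ∃ Q : Measure RightConfig, IsRightRestrictionMeasure (β' - β) Q)
    (hne : Qβ {K : RightConfig | Complex.I ∈ interior (K : Set ℂ)} ≠ 0) :
    Qβ' {K : RightConfig | Complex.I ∈ interior (K : Set ℂ)} ≠ 0 := by
  rcases hββ'.eq_or_lt with heq | hlt
  · subst heq
    rwa [hQβ'.unique hQβ]
  · obtain ⟨Q₃, hQ₃⟩ := hex hlt
    haveI := hQβ.1
    haveI := hQ₃.1
    have hsum : IsRightRestrictionMeasure (β + (β' - β)) Qβ' := by rwa [add_sub_cancel]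
    rw [hsum.unique (hQβ.fillUnion hQ₃), Measure.map_apply RightConfig.measurable_fillUnion
      RightConfig.measurableSet_setOf_I_mem_interior]
    intro h0
    refine hne ?_
    have hsub : {K : RightConfig | Complex.I ∈ interior (K : Set ℂ)} ×ˢ (univ : Set RightConfig) ⊆
        (fun p : RightConfig × RightConfig ↦ RightConfig.fillUnion p.1 p.2) ⁻¹'
          {K : RightConfig | Complex.I ∈ interior (K : Set ℂ)} := by
      rintro ⟨K₁, K₂⟩ ⟨h1, -⟩
      exact interior_mono (RightConfig.subset_fillUnion_left K₁ K₂) h1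
    have := measure_mono_null hsub h0
    rwa [Measure.prod_prod, measure_univ, mul_one] at this

/-- **The core of the `α > 5/8` half, from one-sided restriction**: a two-sided restriction
measure `P` of exponent `α` carried by simple curves (outer reading) and a right-sided
restriction measure `Q₂` of exponent `α − 5/8` charging the event "`i` is interior to `K`"
cannot coexist. With `Q = F^{ℝ₊}_ℍ(P) = F(Q₁ ⊗ Q₂)`, `Q₁ = F^{ℝ₊}_ℍ(P_{5/8})` (§8.1–8.2),
`r = P(i right of K)`, `b = P(i ∈ K)`, `s = Q₂(i ∈ K)`, `q = Q₂(i ∈ int K) > 0`: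
`2r + b = 1`; `r ≤ Q₁(i ∉ K) Q₂(i ∉ K) = (1 − s)/2`, so `s ≤ b`; the right-boundary event
`Bd = {i ∈ K, i ∉ int K}` has `Q(Bd) ≤ Q₁(Bd) + Q₂(Bd) = 0 + (s − q)` (a boundary point of the
filled union is a boundary point of a piece; `Q₁(Bd) ≤ P_{5/8}(i ∈ K) = 0`); and for a simple
curve every point is a limit of points strictly to its right
(`RestrictionConfig.IsSimplePath.mem_closure_rightDomain`), so `b ≤ Q(Bd)`. Hence `q ≤ 0`.
[cite: LawlerSchrammWerner2003Restriction, p. 5 result 2 with §8.1–8.2 and the proof of Cor. 8.6 (p. 38)] -/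
theorem IsRestrictionMeasure.false_of_outer_simple_of_intPos {α : ℝ} {P : Measure RestrictionConfig}
    (hP : IsRestrictionMeasure α P)
    (hsupp : ∀ S : Set RestrictionConfig, MeasurableSet S → {K | K.IsSimplePath} ⊆ S → P S = 1)
    {Q₂ : Measure RightConfig} (hQ₂ : IsRightRestrictionMeasure (α - 5 / 8) Q₂)
    (hq : Q₂ {K : RightConfig | Complex.I ∈ interior (K : Set ℂ)} ≠ 0) : False := by
  haveI := hP.isProbabilityMeasure
  haveI := hQ₂.1
  set InK : Set RestrictionConfig := {K | Complex.I ∈ (K : Set ℂ)} with hInK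
  set ClR : Set RestrictionConfig := {K | Complex.I ∈ closure K.rightDomain} with hClR
  set In' : Set RightConfig := {K | Complex.I ∈ (K : Set ℂ)} with hIn'
  set Int' : Set RightConfig := {K | Complex.I ∈ interior (K : Set ℂ)} with hInt'
  set Bd : Set RightConfig := {K | Complex.I ∈ (K : Set ℂ) ∧ Complex.I ∉ interior (K : Set ℂ)}
    with hBd
  set NotIn : Set RightConfig := {K | Complex.I ∉ (K : Set ℂ)} with hNotIn
  have mInK : MeasurableSet InK := RestrictionConfig.measurableSet_mem Complex.I
  have mClR : MeasurableSet ClR := measurableSet_setOf_I_mem_closure_rightDomain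
  have mIn' : MeasurableSet In' := RightConfig.measurableSet_setOf_mem I_mem_H
  have mInt' : MeasurableSet Int' := RightConfig.measurableSet_setOf_I_mem_interior
  have hBdeq : Bd = In' \ Int' := by
    ext K
    simp [hBd, hIn', hInt']
  have mBd : MeasurableSet Bd := by
    rw [hBdeq]
    exact mIn'.diff mInt'
  have hIntIn : Int' ⊆ In' := by
    intro K hK
    have hK' : Complex.I ∈ interior (K : Set ℂ) := hK
    exact (interior_subset hK' : Complex.I ∈ (K : Set ℂ))
  -- `P_{5/8}` and the one-sided laws
  obtain ⟨P₅, hP₅⟩ := exists_isRestrictionMeasure_five_eighths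
  haveI := hP₅.isProbabilityMeasure
  set Q : Measure RightConfig := P.map leftFillConfig with hQ
  set Q₁ : Measure RightConfig := P₅.map leftFillConfig with hQ₁
  have hQ₁r : IsRightRestrictionMeasure (5 / 8) Q₁ := hP₅.map_leftFillConfig
  haveI := hQ₁r.1
  have hQsum : IsRightRestrictionMeasure (5 / 8 + (α - 5 / 8)) Q := by
    rw [add_sub_cancel]
    exact hP.map_leftFillConfig
  -- (1) `2r + b = 1`, `2r₅ = 1`
  have h1 := hP.two_mul_measure_rightOf_I_add
  have h1₅ := hP₅.two_mul_measure_rightOf_I_add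
  have hb₅ : P₅ InK = 0 := hP₅.measure_setOf_I_mem_eq_zero_of_five_eighths
  rw [hb₅, add_zero] at h1₅
  -- (2) `r ≤ r₅ · Q₂(i ∉ K)`, hence `s ≤ b`
  have h2 : P (rightOf Complex.I) ≤ P₅ (rightOf Complex.I) * Q₂ NotIn := by
    have := hQ₁r.measure_notMem_le_mul hQ₂ hQsum I_mem_H
    rwa [hQ, hP.map_leftFillConfig_setOf_notMem, hQ₁, hP₅.map_leftFillConfig_setOf_notMem] at this
  have hs_compl : Q₂ NotIn + Q₂ In' = 1 := by
    have : NotIn = In'ᶜ := by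
      ext K
      simp [hNotIn, hIn']
    rw [this, add_comm]
    exact prob_add_prob_compl mIn'
  have hsb : Q₂ In' ≤ P InK := by
    have h2' : 2 * P (rightOf Complex.I) ≤ Q₂ NotIn := by
      calc 2 * P (rightOf Complex.I) ≤ 2 * (P₅ (rightOf Complex.I) * Q₂ NotIn) := by gcongr
        _ = (2 * P₅ (rightOf Complex.I)) * Q₂ NotIn := by ring
        _ = Q₂ NotIn := by rw [h1₅, one_mul]
    have h3 : 2 * P (rightOf Complex.I) + Q₂ In' ≤ 2 * P (rightOf Complex.I) + P InK := by
      calc 2 * P (rightOf Complex.I) + Q₂ In' ≤ Q₂ NotIn + Q₂ In' := by gcongr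
        _ = 1 := hs_compl
        _ = 2 * P (rightOf Complex.I) + P InK := h1.symm
    exact (ENNReal.add_le_add_iff_left (by finiteness)).1 h3
  -- (3)+(4) `b ≤ Q(Bd) ≤ Q₁(Bd) + Q₂(Bd)`, `Q₁(Bd) = 0`
  have hb_le : P InK ≤ Q Bd := by
    have hnull : P (InK \ ClR) = 0 := by
      have hS : P (InK \ ClR)ᶜ = 1 := by
        refine hsupp _ (mInK.diff mClR).compl fun K hK ↦ ?_
        simp only [mem_compl_iff, Set.mem_sdiff, not_and, not_not, hInK, hClR, mem_setOf_eq]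
        exact fun hI ↦ hK.mem_closure_rightDomain hI
      exact (prob_compl_eq_one_iff (mInK.diff mClR)).1 hS
    calc P InK = P (InK ∩ ClR) + P (InK \ ClR) := (measure_inter_add_sdiff InK mClR).symm
      _ = P (InK ∩ ClR) := by rw [hnull, add_zero]
      _ ≤ P (leftFillConfig ⁻¹' Bd) := by
          refine measure_mono ?_
          rintro K ⟨hI, hcl⟩
          refine ⟨K.subset_leftFill hI, ?_⟩
          have : K ∈ leftFillConfig ⁻¹' {K' : RightConfig | Complex.I ∉ interior (K' : Set ℂ)} := by
            rw [leftFillConfig_preimage_setOf_I_notMem_interior]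
            exact hcl
          exact this
      _ = Q Bd := by rw [hQ, Measure.map_apply measurable_leftFillConfig mBd]
  have hQ₁Bd : Q₁ Bd = 0 := by
    rw [hQ₁, Measure.map_apply measurable_leftFillConfig mBd]
    refine measure_mono_null ?_ hb₅
    rintro K ⟨hK1, hK2⟩
    exact I_mem_of_leftFill hK1 hK2
  have hQBd : Q Bd ≤ Q₁ Bd + Q₂ Bd := by
    rw [hQsum.unique (hQ₁r.fillUnion hQ₂),
      Measure.map_apply RightConfig.measurable_fillUnion mBd]
    calc (Q₁.prod Q₂) ((fun p : RightConfig × RightConfig ↦ RightConfig.fillUnion p.1 p.2) ⁻¹' Bd)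
        ≤ (Q₁.prod Q₂) (Bd ×ˢ univ ∪ univ ×ˢ Bd) := measure_mono fillUnion_preimage_bd_subset
      _ ≤ (Q₁.prod Q₂) (Bd ×ˢ univ) + (Q₁.prod Q₂) (univ ×ˢ Bd) := measure_union_le _ _
      _ = Q₁ Bd + Q₂ Bd := by
          rw [Measure.prod_prod, Measure.prod_prod, measure_univ, measure_univ, mul_one, one_mul]
  -- (5) `Q₂(Bd) + q = s`
  have h5 : Q₂ Bd + Q₂ Int' = Q₂ In' := by
    rw [hBdeq]
    calc Q₂ (In' \ Int') + Q₂ Int' = Q₂ (In' \ Int') + Q₂ (In' ∩ Int') := by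
          rw [inter_eq_right.2 hIntIn]
      _ = Q₂ In' := measure_sdiff_add_inter In' mInt'
  -- conclusion: `b + q ≤ Q₂(Bd) + q = s ≤ b`, so `q = 0`
  have hle : P InK + Q₂ Int' ≤ P InK + 0 := by
    calc P InK + Q₂ Int' ≤ Q Bd + Q₂ Int' := by gcongr
      _ ≤ (Q₁ Bd + Q₂ Bd) + Q₂ Int' := by gcongr
      _ = Q₂ In' := by rw [hQ₁Bd, zero_add, h5]
      _ ≤ P InK := hsb
      _ = P InK + 0 := (add_zero _).symm
  have hq0 : Q₂ Int' ≤ 0 := (ENNReal.add_le_add_iff_left (by finiteness)).1 hle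
  exact hq (le_zero_iff.1 hq0)

/-- **No `P_α` carried by simple curves has `α > 5/8`**, given the existence of all `P⁺_β`,
`β > 0` ([LSW] Prop. 8.2 / Thm. 8.4) and, for arbitrarily small `β > 0`, a `P⁺_β` under which
`i` is interior to `K` with positive probability (moved up to the exponent `α − 5/8` by
`IsRightRestrictionMeasure.measure_I_mem_interior_ne_zero_mono`).
[cite: LawlerSchrammWerner2003Restriction, p. 5 result 2 with §8.1–8.2] -/
theorem IsRestrictionMeasure.not_five_eighths_lt_of_outer_simple {α : ℝ} {P : Measure RestrictionConfig}
    (hP : IsRestrictionMeasure α P)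
    (hsupp : ∀ S : Set RestrictionConfig, MeasurableSet S → {K | K.IsSimplePath} ⊆ S → P S = 1)
    (hex : ∀ β : ℝ, 0 < β → ∃ Q : Measure RightConfig, IsRightRestrictionMeasure β Q)
    (hint : ∀ ε : ℝ, 0 < ε → ∃ (β : ℝ) (Q : Measure RightConfig), 0 < β ∧ β ≤ ε ∧
      IsRightRestrictionMeasure β Q ∧ Q {K : RightConfig | Complex.I ∈ interior (K : Set ℂ)} ≠ 0) :
    ¬ 5 / 8 < α := by
  intro hα
  obtain ⟨β, Qβ, -, hβle, hQβ, hne⟩ := hint (α - 5 / 8) (by linarith)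
  obtain ⟨Q₂, hQ₂⟩ := hex (α - 5 / 8) (by linarith)
  have hne₂ := hQβ.measure_I_mem_interior_ne_zero_mono hQ₂ hβle (fun _ ↦ hex _ (by linarith)) hne
  exact hP.false_of_outer_simple_of_intPos hsupp hQ₂ hne₂

/-- **[LSW] p. 5 result 2, first sentence (outer reading), WITHOUT §7**: from Cor. 8.6 (`h86`),
the existence of the right-sided restriction measures `P⁺_β`, `β > 0` (`hex`), and "for every
`ε > 0` some `P⁺_β`, `0 < β ≤ ε`, makes `i` an interior point of `K` with positive probability"
(`hint`). The `α > 5/8` half — in [LSW] the Brownian-bubble construction of `P_α` (Thm. 7.3) —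
is replaced by the one-sided argument of `IsRestrictionMeasure.false_of_outer_simple_of_intPos`.
[cite: LawlerSchrammWerner2003Restriction, p. 5 result 2; Cor. 8.6 (p. 37), §8.1–8.2] -/
theorem IsRestrictionMeasure.eq_five_eighths_of_outer_simple_of_oneSided
    (h86 : not_exists_isRestrictionMeasure_of_lt_five_eighths)
    (hex : ∀ β : ℝ, 0 < β → ∃ Q : Measure RightConfig, IsRightRestrictionMeasure β Q)
    (hint : ∀ ε : ℝ, 0 < ε → ∃ (β : ℝ) (Q : Measure RightConfig), 0 < β ∧ β ≤ ε ∧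
      IsRightRestrictionMeasure β Q ∧ Q {K : RightConfig | Complex.I ∈ interior (K : Set ℂ)} ≠ 0) :
    IsRestrictionMeasure.eq_five_eighths_of_outer_simple := by
  intro α P hP hsupp
  rcases (IsRestrictionMeasure.five_eighths_le h86 hP).eq_or_lt with heq | hgt
  · exact heq.symm
  · exact absurd hgt (hP.not_five_eighths_lt_of_outer_simple hsupp hex hint)

/-- The interior positivity implies the positivity `P⁺_β{i ∉ K} < 1` used for Cor. 8.6
(`RestrictionMeasuresFiveEighthsPositivity`). [folklore] -/
theorem pos_of_intPos
    (hint : ∀ ε : ℝ, 0 < ε → ∃ (β : ℝ) (Q : Measure RightConfig), 0 < β ∧ β ≤ ε ∧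
      IsRightRestrictionMeasure β Q ∧ Q {K : RightConfig | Complex.I ∈ interior (K : Set ℂ)} ≠ 0) :
    ∀ ε : ℝ, 0 < ε → ∃ (β : ℝ) (Q : Measure RightConfig), 0 < β ∧ β ≤ ε ∧
      IsRightRestrictionMeasure β Q ∧ Q {K : RightConfig | Complex.I ∉ (K : Set ℂ)} < 1 := by
  intro ε hε
  obtain ⟨β, Q, hβ, hβε, hQ, hne⟩ := hint ε hε
  haveI := hQ.1
  refine ⟨β, Q, hβ, hβε, hQ, ?_⟩
  have hsub : {K : RightConfig | Complex.I ∉ (K : Set ℂ)} ⊆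
      {K : RightConfig | Complex.I ∈ interior (K : Set ℂ)}ᶜ := fun K hK hK' ↦ hK (interior_subset hK')
  calc Q {K : RightConfig | Complex.I ∉ (K : Set ℂ)}
      ≤ Q {K : RightConfig | Complex.I ∈ interior (K : Set ℂ)}ᶜ := measure_mono hsub
    _ = 1 - Q {K : RightConfig | Complex.I ∈ interior (K : Set ℂ)} :=
        prob_compl_eq_one_sub RightConfig.measurableSet_setOf_I_mem_interior
    _ < 1 := ENNReal.sub_lt_self ENNReal.one_ne_top one_ne_zero hne

/-- **[LSW] p. 5 result 2, first sentence (outer reading), from TWO leaves**: the one-sided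
restriction martingale of Lemmas 8.9–8.10 (`hM`, giving Thm. 8.4, hence all `P⁺_β` and — with
the positivity — Cor. 8.6, `not_exists_isRestrictionMeasure_of_lt_five_eighths_of_martingale_of_pos`)
and the small-`β` interior positivity (`hint`). No Brownian bubbles, no Thm. 6.5/7.3.
[cite: LawlerSchrammWerner2003Restriction, p. 5 result 2; Thm. 8.4 (p. 37), Cor. 8.6 (pp. 37–38), §8.1–8.2] -/
theorem IsRestrictionMeasure.eq_five_eighths_of_outer_simple_of_martingale_of_intPos
    (hM : SLEKappaRho.exists_isOneSidedMartingale)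
    (hint : ∀ ε : ℝ, 0 < ε → ∃ (β : ℝ) (Q : Measure RightConfig), 0 < β ∧ β ≤ ε ∧
      IsRightRestrictionMeasure β Q ∧ Q {K : RightConfig | Complex.I ∈ interior (K : Set ℂ)} ≠ 0) :
    IsRestrictionMeasure.eq_five_eighths_of_outer_simple :=
  IsRestrictionMeasure.eq_five_eighths_of_outer_simple_of_oneSided
    (not_exists_isRestrictionMeasure_of_lt_five_eighths_of_martingale_of_pos hM (pos_of_intPos hint))
    (exists_isRightRestrictionMeasure_of_martingale hM) hint

/-- **[LSW] p. 5 result 2, first sentence (almost-everywhere reading,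
`IsRestrictionMeasure.eq_five_eighths_of_simple`), from the same two leaves.**
[cite: LawlerSchrammWerner2003Restriction, p. 5 result 2; Thm. 8.4 (p. 37), Cor. 8.6 (pp. 37–38), §8.1–8.2] -/
theorem IsRestrictionMeasure.eq_five_eighths_of_simple_of_martingale_of_intPos
    (hM : SLEKappaRho.exists_isOneSidedMartingale)
    (hint : ∀ ε : ℝ, 0 < ε → ∃ (β : ℝ) (Q : Measure RightConfig), 0 < β ∧ β ≤ ε ∧
      IsRightRestrictionMeasure β Q ∧ Q {K : RightConfig | Complex.I ∈ interior (K : Set ℂ)} ≠ 0) :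
    IsRestrictionMeasure.eq_five_eighths_of_simple :=
  IsRestrictionMeasure.eq_five_eighths_of_simple_of_outer
    (IsRestrictionMeasure.eq_five_eighths_of_outer_simple_of_martingale_of_intPos hM hint)

/-- **[LSW] p. 5 result 2 (`LawlerSchrammWerner2003`: a conformally covariant chordal family
with two-sided restriction carried by simple curves is chordal SLE_{8/3}) from the same two
leaves**, through `LawlerSchrammWerner2003_of_five_eighths`.
[cite: LawlerSchrammWerner2003Restriction, p. 5 result 2; Prop. 3.3, Thm. 6.1, Thm. 8.4, Cor. 8.6, §8.1–8.2] -/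
theorem LawlerSchrammWerner2003_of_martingale_of_intPos
    (hM : SLEKappaRho.exists_isOneSidedMartingale)
    (hint : ∀ ε : ℝ, 0 < ε → ∃ (β : ℝ) (Q : Measure RightConfig), 0 < β ∧ β ≤ ε ∧
      IsRightRestrictionMeasure β Q ∧ Q {K : RightConfig | Complex.I ∈ interior (K : Set ℂ)} ≠ 0) :
    LawlerSchrammWerner2003 :=
  LawlerSchrammWerner2003_of_five_eighths
    (IsRestrictionMeasure.eq_five_eighths_of_outer_simple_of_martingale_of_intPos hM hint)

end Core

end Literature.Probability.RandomPlanarGeometry
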